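import Summits.Ventures.PercRepro.RankLevelSetLevelFiveArithThreeA
import Summits.Ventures.PercRepro.RankLevelSetLevelFiveArithThreeB
import Summits.Ventures.PercRepro.RankLevelSetLevelFiveArithThreeC
import Summits.Ventures.PercRepro.RankLevelSetCoreFiveTwentyNine

/-!
# PercRepro — S2: THE AUXILIARIES OF THE «31» CHAIN (p7, gen 2; sub-claim S2)

The dispatcher `level_five_poly_three` of the twenty polynomial inequalities (RankLevelSetLevelFiveArithThreeA/B/C), the
regime-II assembly lemma `level_arith_II3` (one middle binomial), and `choose_le_midCount_of_bound'`
(`C(n, s) ≤ #Y(p, q)` for every `B + 1 ≤ s ≤ p − 1`, from the flat bound `B`). Axioms: standard.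
-/

open scoped Matroid

namespace PercRepro

/-- **`(P_d)` at level `5` in the `15/16` form with the SHARPENED multiplicity (partition count), every corank `6 ≤ d ≤ 25`,
every `p ≥ 30`, in `ℚ`** — the dispatcher of the twenty cases of RankLevelSetLevelFiveArithThreeA/B/C. -/
theorem level_five_poly_three (d : ℕ) (hd1 : 6 ≤ d) (hd2 : d ≤ 25) (p : ℕ) (hp : 30 ≤ p) :
    16 * (((p + d).choose 5 : ℚ) +
      (∑ j ∈ Finset.range (d - 5), (Nat.choose (min 13 ((d + 6) / 2 + 1 - 2)) j : ℚ) / (((j + 1) + 3 * (j + 1).choose 2 : ℕ) : ℚ)) *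
        ((d * (d + 1) / 2 * (p + d).choose 3 + d * (d + 1) * (d + 2) / 3 * (p + d).choose 2 + (d + 4).choose 5 * (p + d) + (d + 5).choose 6 : ℕ) : ℚ) +
      ((∑ j ∈ Finset.range (d - 5), (Nat.choose (min 19 (5 + d) - 6) j : ℚ) / (((j + 1) + 3 * (j + 1).choose 2 : ℕ) : ℚ)) -
        (∑ j ∈ Finset.range (d - 5), (Nat.choose (min 5 (d - 1)) j : ℚ) / (((j + 1) + 3 * (j + 1).choose 2 : ℕ) : ℚ))) *
        ((d * (d + 1) / 2 * (min 19 (5 + d)).choose 3 + d * (d + 1) * (d + 2) / 3 * (min 19 (5 + d)).choose 2 + (d + 4).choose 5 * (min 19 (5 + d)) + (d + 5).choose 6 : ℕ) : ℚ)) ≤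
      15 * 2 ^ (d - 5) * ((p + 5).choose 5 : ℚ) := by
  interval_cases d
  · exact level_five_poly_three_6 p hp
  · exact level_five_poly_three_7 p hp
  · exact level_five_poly_three_8 p hp
  · exact level_five_poly_three_9 p hp
  · exact level_five_poly_three_10 p hp
  · exact level_five_poly_three_11 p hp
  · exact level_five_poly_three_12 p hp
  · exact level_five_poly_three_13 p hp
  · exact level_five_poly_three_14 p hp
  · exact level_five_poly_three_15 p hp
  · exact level_five_poly_three_16 p hp
  · exact level_five_poly_three_17 p hp
  · exact level_five_poly_three_18 p hp
  · exact level_five_poly_three_19 p hp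
  · exact level_five_poly_three_20 p hp
  · exact level_five_poly_three_21 p hp
  · exact level_five_poly_three_22 p hp
  · exact level_five_poly_three_23 p hp
  · exact level_five_poly_three_24 p hp
  · exact level_five_poly_three_25 p hp

/-- **The regime-II assembly lemma (one middle binomial)**: from `Φ ≤ 2^(p+5)/C(p+5, 5)`, `U ≤ N`, `C(n, s) ≤ Y` and the
numeral cell `2^(p+5)·N ≤ C(p+5, 5)·C(n, s)`, conclude `Φ·U ≤ Y`. -/
theorem level_arith_II3 {p n s : ℕ} {Φ U Y N : ℚ}
    (hΦ : Φ ≤ (2 : ℚ) ^ (p + 5) / ((p + 5).choose 5 : ℚ)) (hU0 : 0 ≤ U) (hU : U ≤ N)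
    (hY : (n.choose s : ℚ) ≤ Y) (hnum : (2 : ℚ) ^ (p + 5) * N ≤ ((p + 5).choose 5 : ℚ) * (n.choose s : ℚ)) :
    Φ * U ≤ Y := by
  have hc : (0 : ℚ) < ((p + 5).choose 5 : ℚ) := by exact_mod_cast Nat.choose_pos (by omega)
  have h1 : Φ * U ≤ (2 : ℚ) ^ (p + 5) / ((p + 5).choose 5 : ℚ) * U := mul_le_mul_of_nonneg_right hΦ hU0
  have h2 : (2 : ℚ) ^ (p + 5) / ((p + 5).choose 5 : ℚ) * U ≤ (2 : ℚ) ^ (p + 5) / ((p + 5).choose 5 : ℚ) * N :=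
    mul_le_mul_of_nonneg_left hU (by positivity)
  have h3 : (2 : ℚ) ^ (p + 5) / ((p + 5).choose 5 : ℚ) * N ≤ (n.choose s : ℚ) := by
    rw [div_mul_eq_mul_div, div_le_iff₀ hc]
    linarith
  linarith

namespace ThmN

open Set

variable {α : Type}

/-- **`C(n, s) ≤ #Y(p, q)` for every `B + 1 ≤ s ≤ p − 1`** (from the flat bound `B` on rank-`≤ q` sets): every `s`-subset
of `E` has rank `> q` (it has `> B` points) and rank `< p`. -/
theorem choose_le_midCount_of_bound' (M : Matroid α) [M.Finite]
    (hfree : ∀ e ∈ M.E, ∃ A ⊆ M.E \ {e}, e ∉ M.closure A ∧ e ∉ M.closure ((M.E \ {e}) \ A))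
    {p q B s : ℕ} (hBq : ∀ X ⊆ M.E, M.eRk X ≤ q → X.ncard ≤ B) (hs1 : B + 1 ≤ s) (hs2 : s + 1 ≤ p) :
    M.ground_finite.toFinset.card.choose s ≤ Matroid.midCount M p q := by
  have _hL := not_isLoop_of_free M hfree
  have hE : (M.ground_finite.toFinset : Set α) = M.E := Set.Finite.coe_toFinset _
  rw [← ncard_subsets_ncard_eq M.ground_finite.toFinset s]
  unfold Matroid.midCount
  apply Set.ncard_le_ncard
  · intro X hX
    have hXE : X ⊆ M.E := by rw [← hE]; exact hX.1
    have hXfin : X.Finite := M.ground_finite.subset hXE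
    refine ⟨hXE, ?_, ?_⟩
    · by_contra hle
      push Not at hle
      have := hBq X hXE hle
      have hc := hX.2
      omega
    · calc M.eRk X ≤ X.encard := M.eRk_le_encard X
        _ = (s : ℕ∞) := by rw [← hXfin.cast_ncard_eq, hX.2]
        _ < (p : ℕ∞) := by exact_mod_cast (show s < p by omega)
  · exact M.ground_finite.finite_subsets.subset (fun X hX => hX.1)


end ThmN

end PercRepro
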